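import Summits.QuantumFields.BalabanUV.T4Continuum.Support.NE7DatumRefinement
import Summits.QuantumFields.BalabanUV.T4Continuum.Support.NE3HessForm
import Summits.QuantumFields.BalabanUV.T4Continuum.Support.AveragingDeficitMultiLevelPrep
import Summits.QuantumFields.BalabanUV.T4Continuum.Support.AveragingDeficitPeriodicCounting
import HarnessLib

/-!
# NE7ExistenceByInduction — [Balaban1985Variational] Thm 1's PROOF ARCHITECTURE in kernel: EXISTENCE of a good tangent-critical admissible
# configuration on every fibre of the data class at every level (`hexists` of F238) ⇐ B11's INDUCTIVE STEP (Sects. A–G, displayed) for ANY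
# regularity invariant `P` carried along the levels — induction on the level over ALL periods, the previous level's output over the REFINED datum
# (F239) re-read as this level's admissible background

Cell `pub-balaban`, rung (B)+1 sub-cell t4, lineage `b2b-balaban-t4-ne7-p1` (CRUX PROVER NE7 #1 = OWNER of row NE7), generation 88; memo
`t4/b2b-balaban-t4-ne7-p1-g88/EXISTENCE-BY-INDUCTION.md` §3.  File F240 (over F239 `NE7DatumRefinement`).

WHY.  [Balaban1985Variational] p. 279: «Theorem 1 will be proved by induction with respect to `k`. … The first step of the proof, for `k = 1`, will be
covered by the proof of a general case»; Sect. A p. 279: given `V` on `𝔅_k`, refine it to `V₀` on `𝔅_{k−1}` with `V̄₀ = V` ((11)), and take the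
previous minimiser `U_{k−1}(V₀)` — which lies on the fibre of `V` one level up, and is REGULAR by the inductive statement (9)–(10) — as the background
of the step (Sects. B–G: gauge fixing, the linear operators of [B9] AT THAT REGULAR BACKGROUND, the contraction, the regularity of the new minimiser).
THIS FILE is that induction in the tree's vocabulary, with the step DISPLAYED and the regularity invariant ABSTRACT (`P N j U`, any predicate of the
period, the level and the configuration — e.g. the local regular gauges + small current of [B9] (3.35)–(3.36) ∕ [B11] (9)–(10)); the re-reading
«level-`j` good over `D₀` (period `N·L`) ⟹ level-`(j+1)` admissible over `D` (period `N`)» is F239's `mem_admissible_sfClass_succ` with the exact slab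
refinement `exists_datumRefinement`; the base of the induction is the datum itself at level `0`.
WHAT ([folklore] induction; 0 def, 0 sorry).
§1 **`exists_good_of_step`** — for every invariant `P` with `P N 0 D` on the data class `𝒟_β(N) = {unitary, N-periodic, SmallField ≤ 4(e^β − 1)}` (all
   `N ≥ 1`), every `4(e^β−1) ≤ min(ε, δ₁)`, `δ₁L² ≤ ε`, and the STEP «for every `N ≥ 1`, level `j`, datum `D ∈ 𝒟_β(N)` and every `U₀ ∈ admissible
   (sfClass d L N ε) L (j+1) D` with the previous radius `SmallField U₀ (δ₁∕(L^j)²)`, tangent-critical for the FINER constraint (`TangentIter L (j−1)` over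
   period `N·L`, vacuous at `j = 0`) and `P (N·L) j U₀`, there is `U ∈ admissible (sfClass d L N ε) L (j+1) D` with `SmallField U (δ₁∕(L^{j+1})²)`,
   tangent-critical (`TangentIter L j`, period `N`) and `P N (j+1) U`» ⟹ for every `N ≥ 1`, level `j` and `D ∈ 𝒟_β(N)` such a good `U` exists at
   level `j`.
§2 **`hexists_of_step`** — the level-`(k+1)` reading: EXACTLY the hypothesis `hexists` of F238 `NE7OneStepOfExistence` (for every `N ≥ 1`).
THE (A)-BILL AFTER THIS FILE (with F238): X-A4 ∧ **STEP_P** ([B11] Sects. A–G at a `P`-regular background: the inductive step of Thm 1, displayed) ∧ `P` of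
the data ∧ `hleaves²` ∧ two k-free lines.  What STEP_P consumes (future files): the representation ∕ gauge fixing near `U₀` ([B8] ∕ [B10]), the rows of
the linear operators AT `U₀` ([B9] Thm 3.1 ∕ 3.3 (3.42)–(3.47), (3.49) — row NE9), the contraction, the reproduction of `P` ([B9] Hölder rows).
HONEST FRAMING (page 1): an induction over HYPOTHESES; STEP_P and `P` of the data are asserted for nothing; nothing of Bałaban's asserted — p. 279 and
(11) are quoted for the ARCHITECTURE; NOT ONE-STEP, NOT NE7; spine 0∕9; finite T⁴ rung (B)+1 — NOT infinite volume, NOT mass gap, NOT `BetaPertH`, NOT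
Clay.  Continuum YM on T⁴ ⇐ BetaPertH ∧ nine spine estimates (0/9 proved); BetaPertH ⇐ (D1) ∧ (D4) ∧ CAP+tail; G-an2-4 gates asym, D1 and NE2/3/4.
-/

set_option autoImplicit false

open scoped BigOperators Matrix Matrix.Norms.L2Operator
open NormedSpace Finset

namespace Summit.QuantumFields.BalabanUV.T4Continuum.NE7ExistenceByInduction

open Literature.MathematicalPhysics.QuantumFieldTheory.Balaban1983to89
open B7Prop1Explicit B7Prop2Explicit
open T4AveragingDeficitWall (IsUnitaryCfg IsSkewDir SmallField)
open T4AveragingDeficitWallBoundary (IsPeriodicCfg)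
open AveragingDeficitPeriodicCounting (IsPeriodicDir)
open AveragingDeficitMultiLevelPrep (TangentIter)
open MinimalActionLevels (perWin)
open MinimalActionSandwich (admissible)
open MinimalActionRate (sfClass)
open NE3HessForm (dAction)
open NE7DatumRefinement (exists_datumRefinement mem_admissible_sfClass_succ)

noncomputable section

variable {d : ℕ} {n : Type*} [Fintype n] [DecidableEq n]

/-! ## §1 The induction on the level, over all periods, for an arbitrary regularity invariant -/

/-- **EXISTENCE OF A GOOD CONFIGURATION AT EVERY LEVEL ⇐ B11's INDUCTIVE STEP FOR AN ARBITRARY INVARIANT `P`** (statement in the module docstring §1;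
`L ≥ 1`; the tangent-criticality demanded at level `j` is «`dAction U φ = 0` for every skew `(N·L^j)`-periodic `φ` with `TangentIter L k U φ`» whenever
`j = k + 1`, nothing at `j = 0`).  Proof: induction on `j` simultaneously for all periods `N`; at `j = 0` the good configuration over `D` is `D` (the
`0`-fold average is the identity); at `j + 1` the datum is refined (F239 `exists_datumRefinement`: `D₀` of period `N·L`, same radius, `D̄₀ = D`), the
induction hypothesis at period `N·L` gives a level-`j` good `U₀` over `D₀`, which is admissible at level `j+1` over `D` (F239
`mem_admissible_sfClass_succ`, `δ₁L² ≤ ε`), and the step produces `U`. [cite: Balaban1985Variational, Thm 1 p.279, (11) p.279] -/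
theorem exists_good_of_step {L : ℕ} [NeZero L] (hL : 1 ≤ L) {ε δ₁ β : ℝ} (hβε : 4 * (Real.exp β - 1) ≤ ε) (hβδ : 4 * (Real.exp β - 1) ≤ δ₁)
    (hβ0 : 0 ≤ 4 * (Real.exp β - 1)) (hδε : δ₁ * (L : ℝ) ^ 2 ≤ ε)
    (P : ℕ → ℕ → (Site d → Fin d → (Matrix n n ℂ)ˣ) → Prop)
    -- the invariant holds for the data (level `0`)
    (hP0 : ∀ (N : ℕ) [NeZero N] (D : Site d → Fin d → (Matrix n n ℂ)ˣ), IsUnitaryCfg D → IsPeriodicCfg D (N : ℤ) →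
      SmallField D (4 * (Real.exp β - 1)) → P N 0 D)
    -- B11's INDUCTIVE STEP at a `P`-regular, finer-critical background on the fibre (DISPLAYED)
    (hstep : ∀ (N : ℕ) [NeZero N] (j : ℕ) (D : Site d → Fin d → (Matrix n n ℂ)ˣ), IsUnitaryCfg D → IsPeriodicCfg D (N : ℤ) →
      SmallField D (4 * (Real.exp β - 1)) →
      ∀ U₀ ∈ admissible (sfClass d L N ε) L (j + 1) D, SmallField U₀ (δ₁ / ((L : ℝ) ^ j) ^ 2) →
      (∀ k : ℕ, j = k + 1 → ∀ φ : Site d → Fin d → Matrix n n ℂ, IsSkewDir φ → IsPeriodicDir φ ((N * L * L ^ (k + 1) : ℕ) : ℤ) →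
        TangentIter L k U₀ φ → dAction U₀ φ (perWin d (N * L * L ^ (k + 1))) = 0) →
      P (N * L) j U₀ →
      ∃ U ∈ admissible (sfClass d L N ε) L (j + 1) D, SmallField U (δ₁ / ((L : ℝ) ^ (j + 1)) ^ 2) ∧
        (∀ φ : Site d → Fin d → Matrix n n ℂ, IsSkewDir φ → IsPeriodicDir φ ((N * L ^ (j + 1) : ℕ) : ℤ) → TangentIter L j U φ →
          dAction U φ (perWin d (N * L ^ (j + 1))) = 0) ∧
        P N (j + 1) U) :
    ∀ (j N : ℕ) [NeZero N] (D : Site d → Fin d → (Matrix n n ℂ)ˣ), IsUnitaryCfg D → IsPeriodicCfg D (N : ℤ) →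
      SmallField D (4 * (Real.exp β - 1)) →
      ∃ U ∈ admissible (sfClass d L N ε) L j D, SmallField U (δ₁ / ((L : ℝ) ^ j) ^ 2) ∧
        (∀ k : ℕ, j = k + 1 → ∀ φ : Site d → Fin d → Matrix n n ℂ, IsSkewDir φ → IsPeriodicDir φ ((N * L ^ (k + 1) : ℕ) : ℤ) →
          TangentIter L k U φ → dAction U φ (perWin d (N * L ^ (k + 1))) = 0) ∧
        P N j U := by
  intro j
  induction j with
  | zero =>
    -- level `0`: the datum itself (`avgIter L D 0 = D`)
    intro N _ D hDu hDP hDs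
    refine ⟨D, ⟨⟨hDu, ?_, ?_⟩, rfl⟩, ?_, fun k hk => absurd hk (by omega), hP0 N D hDu hDP hDs⟩
    · simpa using hDP
    · simpa using MinimalActionRate.SmallField.mono hDs hβε
    · simpa using MinimalActionRate.SmallField.mono hDs hβδ
  | succ j ih =>
    intro N _ D hDu hDP hDs
    -- refine the datum (period `N·L`, same radius, average `D`) and take the level-`j` good configuration over it
    obtain ⟨D₀, hD₀u, hD₀P, hD₀s, htop, -⟩ := exists_datumRefinement (N := N) hL hDu hDP hβ0 hDs
    haveI : NeZero (N * L) := ⟨Nat.mul_ne_zero (NeZero.ne N) (NeZero.ne L)⟩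
    obtain ⟨U₀, hU₀, hU₀s, hcrit₀, hP₀⟩ := ih (N * L) D₀ hD₀u hD₀P hD₀s
    -- it is admissible at level `j+1` over `D` (period `N`)
    have hU₀' := (mem_admissible_sfClass_succ hL hδε htop hU₀ hU₀s).1
    -- B11's step at this background
    obtain ⟨U, hU, hUs, hcrit, hPU⟩ := hstep N j D hDu hDP hDs U₀ hU₀' hU₀s hcrit₀ hP₀
    refine ⟨U, hU, hUs, fun k hk => ?_, hPU⟩
    obtain rfl : k = j := by omega
    exact hcrit

/-! ## §2 The level-`(k+1)` reading: F238's `hexists` -/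

/-- **`hexists` OF F238 ⇐ B11's INDUCTIVE STEP**: under the hypotheses of `exists_good_of_step`, for every period `N ≥ 1`, every datum `D ∈ 𝒟_β(N)` and
every level `k+1` there is `U♯ ∈ admissible (sfClass d L N ε) L (k+1) D` with `SmallField U♯ (δ₁∕(L^{k+1})²)`, tangent-critical — literally the
hypothesis `hexists` of `NE7OneStepOfExistence.oneStep_of_dataClass_exists_routePi` (and, forgetting it, `P N (k+1) U♯`).
[cite: Balaban1985Variational, Thm 1 p.279] -/
theorem hexists_of_step {L : ℕ} [NeZero L] (hL : 1 ≤ L) {ε δ₁ β : ℝ} (hβε : 4 * (Real.exp β - 1) ≤ ε) (hβδ : 4 * (Real.exp β - 1) ≤ δ₁)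
    (hβ0 : 0 ≤ 4 * (Real.exp β - 1)) (hδε : δ₁ * (L : ℝ) ^ 2 ≤ ε)
    (P : ℕ → ℕ → (Site d → Fin d → (Matrix n n ℂ)ˣ) → Prop)
    (hP0 : ∀ (N : ℕ) [NeZero N] (D : Site d → Fin d → (Matrix n n ℂ)ˣ), IsUnitaryCfg D → IsPeriodicCfg D (N : ℤ) →
      SmallField D (4 * (Real.exp β - 1)) → P N 0 D)
    (hstep : ∀ (N : ℕ) [NeZero N] (j : ℕ) (D : Site d → Fin d → (Matrix n n ℂ)ˣ), IsUnitaryCfg D → IsPeriodicCfg D (N : ℤ) →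
      SmallField D (4 * (Real.exp β - 1)) →
      ∀ U₀ ∈ admissible (sfClass d L N ε) L (j + 1) D, SmallField U₀ (δ₁ / ((L : ℝ) ^ j) ^ 2) →
      (∀ k : ℕ, j = k + 1 → ∀ φ : Site d → Fin d → Matrix n n ℂ, IsSkewDir φ → IsPeriodicDir φ ((N * L * L ^ (k + 1) : ℕ) : ℤ) →
        TangentIter L k U₀ φ → dAction U₀ φ (perWin d (N * L * L ^ (k + 1))) = 0) →
      P (N * L) j U₀ →
      ∃ U ∈ admissible (sfClass d L N ε) L (j + 1) D, SmallField U (δ₁ / ((L : ℝ) ^ (j + 1)) ^ 2) ∧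
        (∀ φ : Site d → Fin d → Matrix n n ℂ, IsSkewDir φ → IsPeriodicDir φ ((N * L ^ (j + 1) : ℕ) : ℤ) → TangentIter L j U φ →
          dAction U φ (perWin d (N * L ^ (j + 1))) = 0) ∧
        P N (j + 1) U)
    (N : ℕ) [NeZero N] :
    ∀ D : Site d → Fin d → (Matrix n n ℂ)ˣ, IsUnitaryCfg D → IsPeriodicCfg D (N : ℤ) → SmallField D (4 * (Real.exp β - 1)) →
      ∀ (k : ℕ), ∃ Us ∈ admissible (sfClass d L N ε) L (k + 1) D, SmallField Us (δ₁ / ((L : ℝ) ^ (k + 1)) ^ 2) ∧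
      (∀ φ : Site d → Fin d → Matrix n n ℂ, IsSkewDir φ → IsPeriodicDir φ ((N * L ^ (k + 1) : ℕ) : ℤ) → TangentIter L k Us φ →
        dAction Us φ (perWin d (N * L ^ (k + 1))) = 0) := by
  intro D hDu hDP hDs k
  obtain ⟨U, hU, hUs, hcrit, -⟩ := exists_good_of_step hL hβε hβδ hβ0 hδε P hP0 hstep (k + 1) N D hDu hDP hDs
  exact ⟨U, hU, hUs, hcrit k rfl⟩

end

end Summit.QuantumFields.BalabanUV.T4Continuum.NE7ExistenceByInduction
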